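import Summits.ABC.IUTFork.Joshi.ATS4VojtaBoundedDegree
import Summits.ABC.IUTFork.Joshi.ATS4VojtaBoundedDegreeAbc
import Summits.ABC.IUTFork.Joshi.ATS4ExistenceLemmasCurves
import HarnessLib

/-!
# Joshi, *Arithmetic Teichmüller Spaces IV* (arXiv:2403.10430v2) §7.1: the INPUTS of the proof of Thm 7.1.1 SUPPLIED —
# merge-debt reconciliation T-33 (`ATS4VojtaBoundedDegree`) ↔ T-29 (`ATS4ExistenceLemmasCurves`, §5.8) ↔ the tree's
# [IUTchIV] Thm 1.10 interface `Cor22.Thm110Legendre`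

Proof-only companion file of the abc-iut cell, branch E (rung LADDER-ABC:A2.E; seat abc-iut-E-t29, fallback §4.4
«merge-debt reconciliation»). **No side is taken** on [IUTchIII] Cor. 3.12 / [IUTchIV] Thm. 1.10, on Joshi's claims
(unrefereed arXiv preprint) or on Mochizuki's report on them; typed ≠ proved ≠ endorsed; NO abc claim. Locators
«p.N l.M» = page files of `HOME/lit/renders/Joshi-arxiv-2403.10430/` (v2).

WHAT §7.1 CONSUMES (p.73 l.9–80) and WHO SUPPLIES IT. E-t33's `ATS4VojtaBoundedDegree.lean` (p430503) proves Thm 7.1.1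
(reduced form `Thm711Reduced`) from an interim carrier `Thm711Inputs`/`PointInputs` listing, per curve `C_λ ∉ Exc`, the
inputs of Thm 5.7.1 / Lem 5.8.7 / Prop 5.6.1 / Thm 6.1.1. This file discharges that merge-debt WITHOUT the carrier, feeding
E-t33's real-algebra core (`Thm711.ineq713`, `Thm711.ineq719_uniform`) directly:
* «ℓ ≥ Q^{1/2}», «ℓ ≤ 10·δ·Q^{1/2}·log(2·δ·Q)», (7.1.2) «(1/6)·Q₂ − (1/6)·q ≤ (1/6)·Q^{1/2}·log(ℓ)» (p.73 l.33, l.65–72) ⇐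
  Lem 5.8.7 at the point, `IsLem587Prime` (T-29, = the tree's (P1)–(P3) `Cor22.exists_prime_P1_P2_P3_point`);
* «for x_λ ∈ Exc the height is bounded» + the hypotheses (P2)/(P5)/(P6), ℓ ≥ 7 that Thm 6.1.1 (= [IUTchIV] Thm 1.10)
  needs ⇐ the threshold form `exists_threshold_P1_to_P6` of T-29's «Completion» (Lem 5.8.9/5.8.11, tree (P4)–(P6));
* Prop 5.6.1 «(1/6)·Q − (1/6)·Q₂ ≤ A_Z», «h ≈ (1/6)·Q» ⇐ `Cor22.partI_holds` ([IUTchIV] Cor 2.2 (i), PROVED in the tree);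
* Thm 6.1.1's first inequality (p.58 l.4–13; p.73 l.14–23) ⇐ the tree's HYPOTHESIS `Cor22.Thm110Legendre` (what the
  proof of [IUTchIV] Cor 2.2 (ii) takes from Thm 1.10 — the disputed chain enters ONLY here, by name) at Joshi's
  `η_prm = 60` (Rmk 6.1.2 / Prop 6.2.1 «π(x) ≤ (4/3)·x/log x for x ≥ 60», [Dusart 2016]; = `IsEtaPrm 60`, E-t30's
  hypothesis; not in the cell's FACT-LIST ⇒ a named HYPOTHESIS here, never asserted).
RESULT: `thm711Reduced_of_thm110Legendre : Cor22.Thm110Legendre → IsEtaPrm 60 → Thm711Reduced` — Joshi's E5 descent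
§5.8 → §6.1 → §7.1 as ONE kernel implication from the two named interfaces (the tree's own [IUTchIV] route
`Cor22.partII_of_thm110Legendre` → Cor 2.3 reaches `VojtaP1Deg` from `Thm110Legendre` for ANY `η_prm`; Joshi's §7.1
arithmetic fixes `η_prm = 60`, hence the extra hypothesis). CONDITIONAL result; no side taken.

MERGE-DEBT DEFECT LOCATED (reported to E-t33 on STATUS; located, not adjudicated): `PointInputs.emod_le_dmod : emod ≤
dmod` (from p.73 l.33–34 «e*_mod ≤ d_mod ≤ δ») together with `dmod ≤ d` forces `e*_mod ≤ d`; but the `emod` slot of its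
field `thm611` is Thm 6.1.1's `e*_mod = 2^12·3^3·5·e_mod ≥ 552960` (p.58 l.13; [J-IV] §4.3; [IUTchIV] Thm 1.10), so
the carrier is instantiable by an honest supplier only when `d ≥ 552960` (`pointInputs_estar_forces`). The printed proof
(p.73 l.55–64) and E-t33's `Thm711.ineq713` use only `e*_mod ≤ δ` — which `Cor22.dstar_le_delta` supplies; this file
therefore routes around the carrier. No new definition, no new `Prop` fact, no sorry.
-/

noncomputable section

namespace Summit.ABC.IUTFork.Joshi.ATS4

open Literature.NumberTheory.DiophantineGeometry Literature.NumberTheory.DiophantineGeometry.GenEll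
open Literature.IUT.LogVolume Literature.IUT.LogVolume.Cor22
open NumberField IsDedekindDomain

/-! ## The located carrier defect, in kernel form -/

/-- **`PointInputs` cannot carry Thm 6.1.1's `e*_mod` unless `d ≥ 552960`**: if the `emod` slot holds
`2^12·3^3·5·e` with `e ≥ 1` (Thm 6.1.1 p.58 l.13, `e*_mod = 2^12·3^3·5·e_mod`, `e_mod ≥ 1`), the fields `emod ≤ dmod ≤ d`
(l.102–104 of `ATS4VojtaBoundedDegree.lean`, p.73 l.33–34 «e*_mod ≤ d_mod ≤ δ») give `552960 ≤ d`. Located, not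
adjudicated; the fix is `emod ≤ delta d` (all that `Thm711.ineq713` uses). [claim: Joshi2024ATS4, status: disputed] -/
theorem pointInputs_estar_forces {d : ℕ} {P : NFPoint} {ℓ : ℕ} {dmod e : ℝ}
    (h : PointInputs d P ℓ dmod (2 ^ 12 * 3 ^ 3 * 5 * e)) (he : 1 ≤ e) : (552960 : ℝ) ≤ d := by
  have h1 := h.emod_le_dmod
  have h2 := h.dmod_le
  nlinarith

/-! ## The suppliers -/

/-- A prime of Lemma 5.8.7 for a curve with `Q > 49` is `≥ 7` (`ℓ ≥ Q^{1/2} > 7`). [folklore] -/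
private theorem seven_le_of_isLem587Prime' {d : ℕ} {P : NFPoint} {ℓ : ℕ} (h : IsLem587Prime d P ℓ)
    (h49 : 49 < logQForall P) : 7 ≤ ℓ := by
  have h7s : (7 : ℝ) < Real.sqrt (logQForall P) := by
    rw [Real.lt_sqrt (by norm_num)]; linarith
  have : (7 : ℝ) < ℓ := lt_of_lt_of_le h7s h.2.1
  exact_mod_cast this.le

/-- **THRESHOLD FORM of the «Completion of the proof of Thm 5.7.1» up to (P6)** (p.57 l.17–26; companion of
`completion_P1_to_P6`, whose `Exc` is here made an explicit `Tate`-threshold): for `Z` as in Thm 5.7.1 and `d ≥ 1` there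
is `B = B(Z, d)` such that every `C_λ ∈ Z ∩ U(Q̄)_{≤d}` with `Tate(C_λ) > B` carries a prime `ℓ ≥ 7` of Lem 5.8.7 with a
multiplicative prime not over `2ℓ` (`Cor22.CondP5`, Lem 5.8.9) and `SL₂(𝔽_ℓ) ⊆ ρ_ℓ(G_L)` (`Cor22.CondP6`, Lem 5.8.11) —
from T-29's `exists_isLem587Prime`, `lem589_holds` and the tree's `Cor22.condP6_of_seven_le`. «for x_λ ∈ Exc, the height is
bounded by some constant depending on d, Z» (p.73 l.10–11) is then `Cor22.partI_holds`. PROVED.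
[claim: Joshi2024ATS4, status: disputed] -/
theorem exists_threshold_P1_to_P6 (D : CBData) (hD : Hypotheses D) {d : ℕ} (hd : 1 ≤ d) :
    ∃ B : ℝ, ∀ P ∈ D.toSet ∩ UPle d, B < logQForall P →
      ∃ ℓ : ℕ, IsLem587Prime d P ℓ ∧ 7 ≤ ℓ ∧ CondP5 P ℓ ∧ CondP6 P ℓ := by
  obtain ⟨ξ, hξ⟩ := exists_isXiPrm
  obtain ⟨B, hB⟩ := lem589_holds D hD hd
  obtain ⟨HK, hHK⟩ := condP6_of_seven_le D
  refine ⟨max (max B 49) (max HK (ξ ^ 2)), ?_⟩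
  rintro P ⟨hPD, hPd⟩ hgt
  have h49 : (49 : ℝ) < logQForall P := lt_of_le_of_lt (le_trans (le_max_right _ _) (le_max_left _ _)) hgt
  have hBlt : B < logQForall P := lt_of_le_of_lt (le_trans (le_max_left _ _) (le_max_left _ _)) hgt
  have hHKlt : HK < logQForall P := lt_of_le_of_lt (le_trans (le_max_left _ _) (le_max_right _ _)) hgt
  have hξ2 : ξ ^ 2 < logQForall P := lt_of_le_of_lt (le_trans (le_max_right _ _) (le_max_right _ _)) hgt
  have hξQ : ξ ≤ Real.sqrt (logQForall P) := by
    have hξ0 : 0 ≤ ξ := le_trans (by norm_num) hξ.1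
    rw [show ξ = Real.sqrt (ξ ^ 2) from (Real.sqrt_sq hξ0).symm]
    exact Real.sqrt_le_sqrt hξ2.le
  obtain ⟨ℓ, hℓ⟩ := exists_isLem587Prime P hPd.2 hξ hξQ
  have h7 : 7 ≤ ℓ := seven_le_of_isLem587Prime' hℓ h49
  have hP5 : CondP5 P ℓ := by
    by_contra hno
    have := hB P ⟨hPD, hPd⟩ ℓ hℓ hno
    linarith
  exact ⟨ℓ, hℓ, h7, hP5, hHK P hPD hPd.1 ℓ hℓ.1 h7 hℓ.2.2.2.1 hP5 hHKlt⟩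

/-- **(7.1.2), first inequality** (p.73 l.65–72 «by … Lemma 5.8.7 one has (1/6)·Tate₂(C_λ) − (1/6)·q ≤
(1/6)·Q^{1/2}·log(ℓ)»): supplied by Lem 5.8.7 (3) at the point (the `a_v < Q^{1/2}` clause of `IsLem587Prime`) through
the tree's `Cor22.logQAvoid_sub_insert_le` ([IUTchIV] p.47). = the `eq712` slot of `PointInputs` (the public decl
`eq712_of_isLem587Prime` is E-t33's, in its companion `ATS4VojtaBoundedDegreeAbc.lean`; private here). PROVED.
[claim: Joshi2024ATS4, status: disputed] -/
private theorem sixth_tate2_sub_le_of_isLem587Prime {d : ℕ} {P : NFPoint} {ℓ : ℕ} (hℓ : IsLem587Prime d P ℓ) :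
    1 / 6 * logQNotTwo P - 1 / 6 * logQAvoid P {2, ℓ} ≤ 1 / 6 * Real.sqrt (logQForall P) * Real.log ℓ := by
  haveI : Fact ℓ.Prime := ⟨hℓ.1⟩
  have h := logQAvoid_sub_insert_le P {2} hℓ.1 (Real.sqrt_nonneg (logQForall P)) (fun v hv hlv =>
    (hℓ.2.2.2.2 v hv ((mem_placesOver_iff_residueChar v).mp (mem_placesOver_of_natCast_mem ℓ v hlv))).le)
  rw [Finset.pair_comm] at h
  have h' : logQNotTwo P - logQAvoid P {2, ℓ} ≤ Real.sqrt (logQForall P) * Real.log ℓ := h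
  linarith

/-- **Thm 6.1.1's first inequality in the shape `Thm711.ineq713` consumes** (p.58 l.4–13 / p.73 l.14–23 «(1/6)·log(q) ≤
(1 + 20·d_mod/ℓ)·(log(𝔡^{L_tpd}) + log(𝔣^{L_tpd})) + 20·(e*_mod·ℓ + 60)»): from the tree's `Cor22.Display P ℓ η` (the
display [IUTchIV] p.46 l.1 takes from Thm 1.10, with `e*_mod ≤ d*_mod` applied and `log(𝔣^{L_tpd})` the conductor away
from `2ℓ`), weakened by `logCondAvoid ≤ logCond` (tree `Cor22.logCondAvoid_le_logCond`) to the point's full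
`log-con`; the `e*_mod` slot carries `d*_mod = 2^12·3^3·5·d_mod`. PROVED (bookkeeping). [claim: Joshi2024ATS4, status: disputed] -/
theorem h611_of_display {P : NFPoint} (hU : P.InU) {ℓ : ℕ} {η : ℝ} (h : Display P ℓ η) :
    1 / 6 * logQAvoid P {2, ℓ} ≤ (1 + 20 * (dmod P : ℝ) / ℓ) * (P.logDiff + P.logCond)
      + 20 * (2 ^ 12 * 3 ^ 3 * 5 * (dmod P : ℝ) * ℓ + η) := by
  unfold Display at h
  have hmono : P.logDiff + logCondAvoid P {2, ℓ} ≤ P.logDiff + P.logCond := by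
    linarith [logCondAvoid_le_logCond P hU {2, ℓ}]
  have hc : 0 ≤ 1 + 20 * (dmod P : ℝ) / ℓ := by positivity
  have := mul_le_mul_of_nonneg_left hmono hc
  linarith

/-! ## §7.1 supplied: Thm 7.1.1 (reduced form) from the two named interfaces -/

/-- **§7.1 for `(Z, d, ε)` with its inputs SUPPLIED** (p.73 l.9 – p.75 l.20): for every compactly bounded `Z` with
{2, ∞} ⊆ S and (5.6.2) (`Cor22.Hypotheses`), `d ≥ 1`, `ε > 0`: `h_{ω_{ℙ¹}(D)} ≲ (1+ε)·(log-diff + log-con)` on `Z ∩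
U(Q̄)_{≤d}` (`GenEll.VojtaIneq`), GIVEN the [IUTchIV] Thm 1.10 interface `Cor22.Thm110Legendre` and Joshi's `η_prm = 60`
(`IsEtaPrm 60`, Prop 6.2.1). Assembly: below the threshold `max(B, 25)` of `exists_threshold_P1_to_P6` the height is
bounded by Prop 5.6.1 (`Cor22.partI_holds`); above it the curve has an `F`-core (`logQForall_le_of_not_admitsCore`:
coreless ⟹ `Q ≤ 12`), `Q^{1/2} > 5`, and the (P1)–(P6) package, so `Thm110Legendre` yields Thm 6.1.1's display, and
E-t33's `Thm711.ineq713` (p.73 l.33–93) + `Thm711.ineq719_uniform` ((7.1.4)–(7.1.9)) finish. CONDITIONAL on the two named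
hypotheses; no side taken; NOT an abc claim. [claim: Joshi2024ATS4, status: disputed] -/
theorem vojtaIneq_of_thm110Legendre (h110 : Thm110Legendre) (h60 : IsEtaPrm 60) (D : CBData) (hD : Hypotheses D)
    {d : ℕ} (hd : 0 < d) {ε : ℝ} (hε : 0 < ε) : VojtaIneq D.toSet d ε := by
  obtain ⟨B, hB⟩ := exists_threshold_P1_to_P6 D hD hd
  obtain ⟨h12, h23, h3⟩ := partI_holds D hD
  obtain ⟨AZ, hAZ⟩ := bdEquiv_iff_abs.mp h12
  obtain ⟨C₀, hC₀⟩ := (h3.symm.trans h23.symm).bdLe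
  have hδ1 : (1 : ℝ) ≤ delta d := one_le_delta hd
  have hδ : 0 < delta d := lt_of_lt_of_le one_pos hδ1
  obtain ⟨A, hA⟩ := Thm711.ineq719_uniform hδ (by positivity : (0 : ℝ) < (15 * delta d) ^ 2) hε (1200 + AZ)
  refine ⟨1 / 6 * |max B 25| + |C₀| + |A|, fun P hP => ?_⟩
  obtain ⟨hPD, hPd⟩ := hP
  have hLD : 0 ≤ P.logDiff + P.logCond := add_nonneg P.logDiff_nonneg P.logCond_nonneg
  have hεLD : 0 ≤ (1 + ε) * (P.logDiff + P.logCond) := mul_nonneg (by linarith) hLD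
  have hht : NFPoint.ht P - 1 / 6 * logQForall P ≤ C₀ := hC₀ P hPD
  have hQ0 : 0 ≤ logQForall P := logQAvoid_nonneg P ∅
  have hBd : max B 25 ≤ |max B 25| := le_abs_self _
  show NFPoint.ht P - (1 + ε) * (P.logDiff + P.logCond) ≤ 1 / 6 * |max B 25| + |C₀| + |A|
  by_cases hle : logQForall P ≤ max B 25
  · -- on `Exc`: the height is bounded (Prop 5.6.1), and `log-diff + log-con ≥ 0`
    linarith [le_abs_self C₀, abs_nonneg A]
  · rw [not_le] at hle
    have hBQ : B < logQForall P := lt_of_le_of_lt (le_max_left _ _) hle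
    have h25 : (25 : ℝ) < logQForall P := lt_of_le_of_lt (le_max_right _ _) hle
    obtain ⟨ℓ, hℓ, h7, hP5, hP6⟩ := hB P ⟨hPD, hPd⟩ hBQ
    have hPU : P ∈ UP := hPd.1
    have hcore : AdmitsCore P := by
      by_contra hno
      have := logQForall_le_of_not_admitsCore hno
      linarith
    have hdisp : Display P ℓ 60 :=
      h110 60 h60 P hPU ℓ hℓ.1 (le_trans (by norm_num) h7) hcore hℓ.2.2.2.1 hP5 hP6
    have h611 := h611_of_display hPU.1 hdisp
    have hsq2 : Real.sqrt (logQForall P) * Real.sqrt (logQForall P) = logQForall P := Real.mul_self_sqrt hQ0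
    have h5 : 5 ≤ Real.sqrt (logQForall P) := by
      rw [show (5 : ℝ) = Real.sqrt (5 ^ 2) from (Real.sqrt_sq (by norm_num)).symm]
      exact Real.sqrt_le_sqrt (by linarith)
    have h712 := sixth_tate2_sub_le_of_isLem587Prime hℓ
    have h561 : 1 / 6 * logQForall P - 1 / 6 * logQNotTwo P ≤ AZ := by
      have hx : |1 / 6 * logQNotTwo P - 1 / 6 * logQForall P| ≤ AZ := hAZ P hPD
      rw [abs_sub_comm] at hx
      exact (le_abs_self _).trans hx
    have h713 := Thm711.ineq713 hsq2 h5 hδ1 (twenty_dmod_le P hPd.2) (dstar_le_delta P hPd.2) hLD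
      hℓ.2.1 hℓ.2.2.1 h611 h712 h561
    have h719 := hA (logQForall P) _ hQ0 hLD h713
    linarith [le_abs_self A, le_abs_self C₀, abs_nonneg (max B 25)]

/-- **Joshi's Thm 7.1.1 (reduced form, E-t33's `Thm711Reduced`) from the two named interfaces**: the [IUTchIV] Thm
1.10 interface `Cor22.Thm110Legendre` (HYPOTHESIS — rests on [IUTchIII] Cor. 3.12; never asserted) and `η_prm = 60`
(`IsEtaPrm 60`, Joshi's Prop 6.2.1, HYPOTHESIS). Everything else in §5.8/§7.1 is PROVED (T-29, T-33, the tree). With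
E-t33's `abc_of_thm711Reduced` this is Joshi's §7.2 chain as an implication only; the tree's own route
(`Cor22.partII_of_thm110Legendre` → Cor 2.3) needs no `η_prm = 60`. No side taken; NO abc claim.
[claim: Joshi2024ATS4, status: disputed] -/
theorem thm711Reduced_of_thm110Legendre (h110 : Thm110Legendre) (h60 : IsEtaPrm 60) : Thm711Reduced :=
  fun D hD _ hd _ hε => vojtaIneq_of_thm110Legendre h110 h60 D hD hd hε

/-! ## Appendix (after E-t33's `ATS4VojtaBoundedDegreeAbc.lean`, p432393): the §7 residual `Thm611OnLambdaLine` SUPPLIED -/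

/-- **Thm 6.1.1 AS CONSUMED at `C_λ` (E-t33's `Thm611Consumed d P ℓ`) from the tree's display** `Cor22.Display P ℓ 60`: the
`d_mod`/`e*_mod` slots of `h611_of_display` are bounded by `d_mod ≤ d` (`Cor22.dmod_le_degree`) and `d*_mod ≤ δ`
(`Cor22.dstar_le_delta`) — exactly the substitution «e*_mod ≤ d_mod ≤ δ» of p.73 l.33–35 in its used form (F6). PROVED.
[claim: Joshi2024ATS4, status: disputed] -/
theorem thm611Consumed_of_display {d : ℕ} {P : NFPoint} (hPd : P ∈ UPle d) {ℓ : ℕ} (hℓ : 0 < ℓ)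
    (h : Display P ℓ 60) : Thm611Consumed d P ℓ := by
  have h1 := h611_of_display hPd.1.1 h
  have hLD : 0 ≤ P.logDiff + P.logCond := add_nonneg P.logDiff_nonneg P.logCond_nonneg
  have hl : (0 : ℝ) < ℓ := by exact_mod_cast hℓ
  have hdm : (dmod P : ℝ) ≤ d := by exact_mod_cast (dmod_le_degree P).trans hPd.2
  have hds : 2 ^ 12 * 3 ^ 3 * 5 * (dmod P : ℝ) ≤ delta d := dstar_le_delta P hPd.2
  have hc : (1 + 20 * (dmod P : ℝ) / ℓ) * (P.logDiff + P.logCond) ≤ (1 + 20 * (d : ℝ) / ℓ) * (P.logDiff + P.logCond) := by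
    apply mul_le_mul_of_nonneg_right _ hLD
    have : 20 * (dmod P : ℝ) / ℓ ≤ 20 * (d : ℝ) / ℓ := div_le_div_of_nonneg_right (by linarith) hl.le
    linarith
  have he : 2 ^ 12 * 3 ^ 3 * 5 * (dmod P : ℝ) * ℓ ≤ delta d * ℓ := mul_le_mul_of_nonneg_right hds hl.le
  unfold Thm611Consumed
  linarith

/-- **The §7 residual SUPPLIED: `Thm611OnLambdaLine Z d` from the two named interfaces** — the [IUTchIV] Thm 1.10 interface
`Cor22.Thm110Legendre` (HYPOTHESIS; the disputed chain, by name) and `η_prm = 60` (`IsEtaPrm 60`, Joshi's Prop 6.2.1,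
HYPOTHESIS) — for every `Z` with (5.6.2) and `d ≥ 1`: `Exc` = the curves of `Z ∩ U(Q̄)_{≤d}` with `Tate(C_λ) ≤ max(B, 12)`
(bounded height by Prop 5.6.1 = `Cor22.partI_holds`; `B` of `exists_threshold_P1_to_P6`; `12` puts the coreless curves,
`Cor22.logQForall_le_of_not_admitsCore`, inside), and off it the (P1)–(P6) package feeds `Thm110Legendre`. With E-t33's
`thm711Reduced_of_thm611OnLambdaLine` / `thm721_of_thm611OnLambdaLine` this re-derives `thm711Reduced_of_thm110Legendre`
through the residual. CONDITIONAL; no side taken; NOT an abc claim. [claim: Joshi2024ATS4, status: disputed] -/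
theorem thm611OnLambdaLine_of_thm110Legendre (h110 : Thm110Legendre) (h60 : IsEtaPrm 60) (D : CBData)
    (hD : Hypotheses D) {d : ℕ} (hd : 0 < d) : Thm611OnLambdaLine D d := by
  obtain ⟨B, hB⟩ := exists_threshold_P1_to_P6 D hD hd
  obtain ⟨_, h23, h3⟩ := partI_holds D hD
  obtain ⟨C₀, hC₀⟩ := (h3.symm.trans h23.symm).bdLe
  refine ⟨{P | P ∈ D.toSet ∩ UPle d ∧ logQForall P ≤ max B 12}, ⟨1 / 6 * max B 12 + C₀, ?_⟩, ?_⟩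
  · rintro P ⟨⟨hPD, _⟩, hPB⟩
    have hx : NFPoint.ht P - 1 / 6 * logQForall P ≤ C₀ := hC₀ P hPD
    linarith
  · rintro P ⟨hPD, hPd⟩ hPexc
    have hgt : max B 12 < logQForall P := by
      by_contra hle
      exact hPexc ⟨⟨hPD, hPd⟩, not_lt.mp hle⟩
    obtain ⟨ℓ, hℓ, h7, hP5, hP6⟩ := hB P ⟨hPD, hPd⟩ (lt_of_le_of_lt (le_max_left _ _) hgt)
    have hcore : AdmitsCore P := by
      by_contra hno
      have := logQForall_le_of_not_admitsCore hno
      linarith [le_max_right B 12]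
    have hdisp : Display P ℓ 60 :=
      h110 60 h60 P hPd.1 ℓ hℓ.1 (le_trans (by norm_num) h7) hcore hℓ.2.2.2.1 hP5 hP6
    exact ⟨ℓ, hℓ, thm611Consumed_of_display hPd hℓ.1.pos hdisp⟩

/-- The two routes agree: through the residual one recovers `thm711Reduced_of_thm110Legendre` (E-t33's
`thm711Reduced_of_thm611OnLambdaLine` ∘ `thm611OnLambdaLine_of_thm110Legendre`). PROVED. [claim: Joshi2024ATS4, status: disputed] -/
theorem thm711Reduced_of_thm110Legendre' (h110 : Thm110Legendre) (h60 : IsEtaPrm 60) : Thm711Reduced :=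
  thm711Reduced_of_thm611OnLambdaLine fun D hD _ hd => thm611OnLambdaLine_of_thm110Legendre h110 h60 D hD hd

end Summit.ABC.IUTFork.Joshi.ATS4

end
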